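import Mathlib.MeasureTheory.Measure.WithDensity
import Mathlib.MeasureTheory.Integral.Lebesgue.Map
import Mathlib.MeasureTheory.Measure.OpenPos
import Mathlib.MeasureTheory.Measure.Typeclasses.Finite
import Mathlib.MeasureTheory.Constructions.BorelSpace.Basic
import Mathlib.Topology.ContinuousOn

/-!
# POSITIVITY OF A CONTINUOUS PUSH-FORWARD DENSITY AT A POINT, TRANSFERRED THROUGH CHARTS — a density that is continuous at `y₀`
# and whose measure dominates `c·μ` on arbitrarily small sets around `y₀` is `≥ c` at `y₀`; hence the positivity of a chart-level
# local push-forward density at the base point passes to ANY group-level density of the same push-forward that is continuous there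

Generic measure theory (Mathlib only; every declaration a THEOREM, no `def`, no `sorry`).  LOCATED CONSUMER (cell `pub-ymgap`, YM-PLAN
Track A, node N09 [B12] width seat `pub-ymgap-dag-n09-w2` g5, Literature proof lane `--supports` K1⁹ `StabilityBRunRowsAtRecordR13SepCoPHV`
= stmt-QuantumFields-27364, count-neutral): the POSITIVITY half (F3) of the located debt «Jacobian face of [Balaban1987RG1] (0.4)» on the
LOCAL ROUTE (road B).  Road B produces, per fine configuration, a flat local face of the chart-read averaging (this seat's
`SubmersionPushforward.exists_continuousOn_density_map_of_submersion(_pos)`), transports it through the exponential charts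
(`PushforwardDensityChartTransport.localFace_of_chartRead`, `HaarExpChartLocalFaceTransport`) and glues (`PushforwardDensityGluing`) —
all stated as EXISTENCE of continuous densities, through which the VALUE at the base point is invisible.  The regularity tower reads
`A_{k+1} = log(𝐍_k⁻¹·T_kρ_k)` ([Balaban1987RG1] (0.19) p. 255), so it needs `T_kρ_k > 0` POINTWISE on the next small-field domain.  THIS
FILE supplies the missing transfer WITHOUT re-running any transport or gluing proof: positivity is read off by comparing the masses of
the SAME small sets `Θ_Y(W)` at chart and group level.

WHAT IS PROVED (namespace `Literature.MeasureTheory.Integral.PushforwardDensityPositivity`).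
* §1 ★ `le_of_continuousAt_of_forall_nhds_setLIntegral_ge` — if `I` is continuous at `y₀` and every neighbourhood of `y₀` contains a
  measurable `B` with `0 < μ B < ∞` and `c·μ B ≤ ∫⁻_B I dμ` (`0 < c`), then `c ≤ I y₀`.
* §2 ★★★ `density_ge_of_chartRead`, ★★ `density_pos_of_chartRead` — the CHART-DATA setting of `PushforwardDensityChartTransport.localFace_of_chartRead`
  (source chart `Θ_X` on `T` with Jacobian `J_X` and `ν⌊Θ_X(T) = Θ_X_*((J_X)·μE⌊T)`; target chart `Θ_Y` on `S`, injective, continuous, open,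
  with measurable left inverse `Λ_Y` and Jacobian `J_Y > 0`, `μG⌊Θ_Y(S) = Θ_Y_*((J_Y)·μY⌊S)`; `M (Θ_X e) ∈ Θ_Y(S)` on `T₀ ∋ e₀`): if a
  chart-level density `r_E ≤ (r∘Θ_X)·J_X` on `T`, vanishing off `T₀`, has under the chart-read map `Λ_Y∘M∘Θ_X` above an open
  `D ∋ u₀ := Λ_Y(M(Θ_X e₀))` a density `I_E` continuous at `u₀` with `0 < I_E(u₀)`, and `I` is ANY (super-)density of `M_*(r·ν)` above an
  open `D_G ∋ M(Θ_X e₀)` (`(r·ν)(M⁻¹B) ≤ ∫⁻_B I dμG`) continuous at that point, then `I_E(u₀) ∕ (4·J_Y(u₀)) ≤ I(M(Θ_X e₀))`, in particular `0 < I(M(Θ_X e₀))`.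

HONEST SCOPE.  (i) Pure bookkeeping of measures of small sets; no chart is constructed here and nothing model-specific is claimed (no
statement about Bałaban's averaging, N09 or the Clay problem).  (ii) `μY` locally finite and positive on open sets; the factor `1∕4` is
an artefact of the halving windows, not optimal.
-/

noncomputable section

namespace Literature.MeasureTheory.Integral.PushforwardDensityPositivity

open _root_.MeasureTheory _root_.MeasureTheory.Measure Set Function Filter
open scoped ENNReal NNReal Topology

/-! ## §1 A density lower bound at a continuity point from local mass lower bounds -/

section Core

variable {G : Type*} [TopologicalSpace G] [MeasurableSpace G] {μ : Measure G}

/-- ★ **DENSITY LOWER BOUND AT A CONTINUITY POINT.**  If `I` is continuous at `y₀` and inside every neighbourhood of `y₀` there is a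
measurable set `B` of positive finite measure with `c·μ(B) ≤ ∫⁻_B I dμ`, `0 < c`, then `c ≤ I(y₀)` (otherwise `I < c' < c` near `y₀` and the
mass of a small `B` is at most `c'·μ(B)`). [cite: EvansGariepy1992, §1.6.1 Thm 1 (differentiation of measures; the trivial direction at a continuity point)] -/
theorem le_of_continuousAt_of_forall_nhds_setLIntegral_ge {I : G → ℝ} {y₀ : G} (hI : ContinuousAt I y₀) {c : ℝ} (hc : 0 < c)
    (h : ∀ N ∈ 𝓝 y₀, ∃ B ⊆ N, MeasurableSet B ∧ μ B ≠ 0 ∧ μ B ≠ ∞ ∧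
      ENNReal.ofReal c * μ B ≤ ∫⁻ y in B, ENNReal.ofReal (I y) ∂μ) :
    c ≤ I y₀ := by
  refine le_of_not_gt fun hlt => ?_
  obtain ⟨c', hIc', hc'c⟩ := exists_between hlt
  obtain ⟨B, hBN, -, hB0, hBtop, hle⟩ := h _ (hI.preimage_mem_nhds (Iio_mem_nhds hIc'))
  have hup : ∫⁻ y in B, ENNReal.ofReal (I y) ∂μ ≤ ENNReal.ofReal c' * μ B := by
    calc ∫⁻ y in B, ENNReal.ofReal (I y) ∂μ ≤ ∫⁻ _ in B, ENNReal.ofReal c' ∂μ :=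
          setLIntegral_mono measurable_const fun y hy => ENNReal.ofReal_le_ofReal (le_of_lt (hBN hy))
      _ = ENNReal.ofReal c' * μ B := setLIntegral_const _ _
  have h2 : ENNReal.ofReal c ≤ ENNReal.ofReal c' := (ENNReal.mul_le_mul_iff_left hB0 hBtop).1 (hle.trans hup)
  have hc'0 : 0 < c' := by
    refine lt_of_not_ge fun hneg => ?_
    rw [ENNReal.ofReal_of_nonpos hneg, nonpos_iff_eq_zero, ENNReal.ofReal_eq_zero] at h2
    exact absurd h2 (not_le.2 hc)
  exact absurd ((ENNReal.ofReal_le_ofReal_iff hc'0.le).1 h2) (not_le.2 hc'c)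

end Core

/-! ## §2 Positivity transfer through a pair of charts -/

section Transfer

variable {E : Type*} [TopologicalSpace E] [MeasurableSpace E] [OpensMeasurableSpace E]
  {Y : Type*} [TopologicalSpace Y] [MeasurableSpace Y] [OpensMeasurableSpace Y]
  {X : Type*} [TopologicalSpace X] [MeasurableSpace X] [OpensMeasurableSpace X]
  {G : Type*} [TopologicalSpace G] [MeasurableSpace G] [OpensMeasurableSpace G]

/-- ★★★ **QUANTITATIVE POSITIVITY TRANSFER THROUGH CHARTS.**  Chart data as in `PushforwardDensityChartTransport.localFace_of_chartRead` (source
chart `ΘX` with Jacobian `JX ≥ 0` and `ν⌊ΘX(T) = ΘX_*((JX)·μE⌊T)`, `ΘX(T)` open; target chart `ΘY` injective, continuous and open on the open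
`S`, left-inverted by a measurable `ΛY`, Jacobian `JY` continuous and positive on `S`, `μG⌊ΘY(S) = ΘY_*((JY)·μY⌊S)`; `M(ΘX e) ∈ ΘY(S)` for
`e ∈ T₀ ⊆ T`, `e₀ ∈ T₀`), `μY` locally finite and positive on open sets.  Let `r ≥ 0` be a measurable density on `X` and `rE ≥ 0` a measurable
density on `E` with `rE ≤ (r∘ΘX)·JX` on `T` and `rE = 0` off `T₀`, whose push-forward under the chart-read map `e ↦ ΛY(M(ΘX e))` has above
an open `D ∋ u₀ := ΛY(M(ΘX e₀))` a density `IE`, continuous at `u₀`, `0 < IE u₀`.  Then EVERY (super-)density `I` of `M_*(r·ν)` above an open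
`DG ∋ M(ΘX e₀)` (`(r·ν)(M⁻¹B) ≤ ∫⁻_B I dμG` for measurable `B ⊆ DG`) that is continuous at `M(ΘX e₀)` satisfies `IE(u₀) ∕ (4·JY(u₀)) ≤ I(M(ΘX e₀))` — by comparing, for small open `W ∋ u₀`, the
two masses of `ΘY(W)`: `μG(ΘY W) ≤ 2JY(u₀)·μY(W)` and `(r·ν)(M⁻¹ ΘY W) ≥ (rE·μE)((ΛY∘M∘ΘX)⁻¹ W) ≥ ½IE(u₀)·μY(W)`.
[cite: HormanderALPDO1, §6.1, proof of Thm 6.1.2 (local coordinates for a submersion; bookkeeping)] [cite: EvansGariepy1992, §1.6.1 Thm 1] -/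
theorem density_ge_of_chartRead (μE : Measure E) (μY : Measure Y) (ν : Measure X) (μG : Measure G)
    [IsLocallyFiniteMeasure μY] [μY.IsOpenPosMeasure]
    -- source chart
    {ΘX : E → X} (hΘXm : Measurable ΘX) {T T₀ : Set E} (hT : IsOpen T) (hT₀T : T₀ ⊆ T) (hΘXT : IsOpen (ΘX '' T))
    {JX : E → ℝ} (hJXm : Measurable JX) (hJX0 : ∀ e, 0 ≤ JX e)
    (hcovX : ν.restrict (ΘX '' T) = ((μE.restrict T).withDensity fun e => ENNReal.ofReal (JX e)).map ΘX)
    -- target chart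
    {ΘY : Y → G} (hΘYm : Measurable ΘY) {S : Set Y} (hS : IsOpen S) (hΘYi : InjOn ΘY S) (hΘYc : ContinuousOn ΘY S)
    (hΘYo : ∀ V : Set Y, V ⊆ S → IsOpen V → IsOpen (ΘY '' V)) {ΛY : G → Y} (hΛYm : Measurable ΛY)
    (hΛΘ : ∀ u ∈ S, ΛY (ΘY u) = u)
    {JY : Y → ℝ} (hJYm : Measurable JY) (hJYc : ContinuousOn JY S) (hJYpos : ∀ u ∈ S, 0 < JY u)
    (hcovY : μG.restrict (ΘY '' S) = ((μY.restrict S).withDensity fun u => ENNReal.ofReal (JY u)).map ΘY)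
    -- the map, the base point, chart-readability
    {M : X → G} (hMm : Measurable M) {e₀ : E} (he₀ : e₀ ∈ T₀) (hread : ∀ e ∈ T₀, M (ΘX e) ∈ ΘY '' S)
    -- the densities
    {r : X → ℝ} (hrm : Measurable r)
    {rE : E → ℝ} (hrEle : ∀ e ∈ T, rE e ≤ r (ΘX e) * JX e) (hrET₀ : ∀ e, e ∉ T₀ → rE e = 0)
    -- the chart-level density of the push-forward of `rE` under the chart-read map
    {D : Set Y} (hD : IsOpen D) (hu₀D : ΛY (M (ΘX e₀)) ∈ D) {IE : Y → ℝ} (hIEc : ContinuousAt IE (ΛY (M (ΘX e₀))))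
    (hIEpos : 0 < IE (ΛY (M (ΘX e₀))))
    (hIE : ∀ A : Set Y, MeasurableSet A → A ⊆ D →
      (μE.withDensity fun e => ENNReal.ofReal (rE e)) ((fun e => ΛY (M (ΘX e))) ⁻¹' A) = ∫⁻ w in A, ENNReal.ofReal (IE w) ∂μY)
    -- the group-level density of `M_*(r ν)`
    {DG : Set G} (hDG : IsOpen DG) (hMaDG : M (ΘX e₀) ∈ DG) {I : G → ℝ} (hIc : ContinuousAt I (M (ΘX e₀)))
    (hI : ∀ B : Set G, MeasurableSet B → B ⊆ DG →
      (ν.withDensity fun x => ENNReal.ofReal (r x)) (M ⁻¹' B) ≤ ∫⁻ y in B, ENNReal.ofReal (I y) ∂μG) :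
    IE (ΛY (M (ΘX e₀))) / (4 * JY (ΛY (M (ΘX e₀)))) ≤ I (M (ΘX e₀)) := by
  -- the base point in the target chart
  obtain ⟨u₀, hu₀S, hu₀⟩ := hread e₀ he₀
  have hΛu₀ : ΛY (M (ΘX e₀)) = u₀ := by rw [← hu₀, hΛΘ u₀ hu₀S]
  rw [hΛu₀] at hu₀D hIEc hIEpos ⊢
  have hJY₀ : 0 < JY u₀ := hJYpos u₀ hu₀S
  have hc : 0 < IE u₀ / (4 * JY u₀) := div_pos hIEpos (by positivity)
  -- the chart-read map is measurable
  have hm : Measurable fun e => ΛY (M (ΘX e)) := hΛYm.comp (hMm.comp hΘXm)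
  refine le_of_continuousAt_of_forall_nhds_setLIntegral_ge (μ := μG) hIc hc fun N hN => ?_
  -- a small open `W ∋ u₀` inside `S ∩ D`, of finite `μY`-measure, mapped by `ΘY` into `N ∩ DG`, on which `IE > IE₀/2` and `JY₀/2 < JY < 2JY₀`
  obtain ⟨F, hF, hμF⟩ := μY.finiteAt_nhds u₀
  have hΘYu₀ : ContinuousAt ΘY u₀ := hΘYc.continuousAt (hS.mem_nhds hu₀S)
  have hJYu₀ : ContinuousAt JY u₀ := hJYc.continuousAt (hS.mem_nhds hu₀S)
  have hP : S ∩ D ∩ F ∩ ΘY ⁻¹' (N ∩ DG) ∩ IE ⁻¹' Ioi (IE u₀ / 2) ∩ JY ⁻¹' Ioo (JY u₀ / 2) (2 * JY u₀) ∈ 𝓝 u₀ := by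
    refine inter_mem (inter_mem (inter_mem (inter_mem (inter_mem (hS.mem_nhds hu₀S) (hD.mem_nhds hu₀D)) hF) ?_) ?_) ?_
    · exact hΘYu₀.preimage_mem_nhds (by rw [hu₀]; exact inter_mem hN (hDG.mem_nhds hMaDG))
    · exact hIEc.preimage_mem_nhds (Ioi_mem_nhds (by linarith))
    · exact hJYu₀.preimage_mem_nhds (Ioo_mem_nhds (by linarith) (by linarith))
  obtain ⟨W, hWP, hWo, hu₀W⟩ := _root_.mem_nhds_iff.1 hP
  have hWS : W ⊆ S := fun u hu => (hWP hu).1.1.1.1.1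
  have hWD : W ⊆ D := fun u hu => (hWP hu).1.1.1.1.2
  have hWF : W ⊆ F := fun u hu => (hWP hu).1.1.1.2
  have hWN : ∀ u ∈ W, ΘY u ∈ N ∩ DG := fun u hu => (hWP hu).1.1.2
  have hWIE : ∀ u ∈ W, IE u₀ / 2 < IE u := fun u hu => (hWP hu).1.2
  have hWJY : ∀ u ∈ W, JY u₀ / 2 < JY u ∧ JY u < 2 * JY u₀ := fun u hu => (hWP hu).2
  have hWm : MeasurableSet W := hWo.measurableSet
  have hμW0 : μY W ≠ 0 := (hWo.measure_pos μY ⟨u₀, hu₀W⟩).ne'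
  have hμWtop : μY W ≠ ∞ := (lt_of_le_of_lt (measure_mono hWF) hμF).ne
  -- the set `B := ΘY '' W`
  set B : Set G := ΘY '' W with hBdef
  have hBo : IsOpen B := hΘYo W hWS hWo
  have hBm : MeasurableSet B := hBo.measurableSet
  have hBN : B ⊆ N := by rintro _ ⟨u, hu, rfl⟩; exact (hWN u hu).1
  have hBDG : B ⊆ DG := by rintro _ ⟨u, hu, rfl⟩; exact (hWN u hu).2
  have hBS : B ⊆ ΘY '' S := image_mono hWS
  have hpreB : ΘY ⁻¹' B ∩ S = W := by
    ext u
    constructor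
    · rintro ⟨⟨w, hw, hwu⟩, huS⟩
      have : w = u := hΘYi (hWS hw) huS hwu
      exact this ▸ hw
    · exact fun hu => ⟨⟨u, hu, rfl⟩, hWS hu⟩
  -- `μG B = ∫⁻_W JY dμY`
  have hμGB : μG B = ∫⁻ u in W, ENNReal.ofReal (JY u) ∂μY := by
    calc μG B = μG.restrict (ΘY '' S) B := by rw [Measure.restrict_apply hBm, inter_eq_left.2 hBS]
      _ = (((μY.restrict S).withDensity fun u => ENNReal.ofReal (JY u)).map ΘY) B := by rw [hcovY]
      _ = ((μY.restrict S).withDensity fun u => ENNReal.ofReal (JY u)) (ΘY ⁻¹' B) := Measure.map_apply hΘYm hBm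
      _ = ∫⁻ u in ΘY ⁻¹' B, ENNReal.ofReal (JY u) ∂(μY.restrict S) := withDensity_apply _ (hΘYm hBm)
      _ = ∫⁻ u in W, ENNReal.ofReal (JY u) ∂μY := by rw [Measure.restrict_restrict (hΘYm hBm), hpreB]
  have hμGB_le : μG B ≤ ENNReal.ofReal (2 * JY u₀) * μY W := by
    rw [hμGB, ← setLIntegral_const]
    exact setLIntegral_mono measurable_const fun u hu => ENNReal.ofReal_le_ofReal (hWJY u hu).2.le
  have hμGB_ge : ENNReal.ofReal (JY u₀ / 2) * μY W ≤ μG B := by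
    rw [hμGB, ← setLIntegral_const]
    exact setLIntegral_mono ((ENNReal.measurable_ofReal.comp hJYm)) fun u hu => ENNReal.ofReal_le_ofReal (hWJY u hu).1.le
  have hB0 : μG B ≠ 0 := by
    refine (lt_of_lt_of_le ?_ hμGB_ge).ne'
    exact ENNReal.mul_pos (ENNReal.ofReal_pos.2 (by linarith)).ne' hμW0
  have hBtop : μG B ≠ ∞ :=
    (lt_of_le_of_lt hμGB_le (ENNReal.mul_lt_top ENNReal.ofReal_lt_top hμWtop.lt_top)).ne
  refine ⟨B, hBN, hBm, hB0, hBtop, ?_⟩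
  -- the mass of `B` under `M_*(r ν)` read through the source chart and bounded below by the chart-level density
  have hstep1 : (ν.withDensity fun x => ENNReal.ofReal (r x)) (M ⁻¹' B) ≥
      ∫⁻ e in ΘX ⁻¹' (M ⁻¹' B) ∩ T, ENNReal.ofReal (JX e) * ENNReal.ofReal (r (ΘX e)) ∂μE := by
    calc (ν.withDensity fun x => ENNReal.ofReal (r x)) (M ⁻¹' B)
        ≥ (ν.withDensity fun x => ENNReal.ofReal (r x)) (M ⁻¹' B ∩ ΘX '' T) := measure_mono inter_subset_left
      _ = ((ν.withDensity fun x => ENNReal.ofReal (r x)).restrict (ΘX '' T)) (M ⁻¹' B) :=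
          (Measure.restrict_apply (hMm hBm)).symm
      _ = ((ν.restrict (ΘX '' T)).withDensity fun x => ENNReal.ofReal (r x)) (M ⁻¹' B) := by
          rw [restrict_withDensity hΘXT.measurableSet]
      _ = ∫⁻ x in M ⁻¹' B, ENNReal.ofReal (r x) ∂(ν.restrict (ΘX '' T)) := withDensity_apply _ (hMm hBm)
      _ = ∫⁻ x in M ⁻¹' B, ENNReal.ofReal (r x) ∂(((μE.restrict T).withDensity fun e => ENNReal.ofReal (JX e)).map ΘX) := by
          rw [hcovX]
      _ = ∫⁻ e in ΘX ⁻¹' (M ⁻¹' B), ENNReal.ofReal (r (ΘX e)) ∂((μE.restrict T).withDensity fun e => ENNReal.ofReal (JX e)) :=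
          setLIntegral_map (hMm hBm) (ENNReal.measurable_ofReal.comp hrm) hΘXm
      _ = ∫⁻ e in ΘX ⁻¹' (M ⁻¹' B), ((fun e => ENNReal.ofReal (JX e)) * fun e => ENNReal.ofReal (r (ΘX e))) e ∂(μE.restrict T) :=
          setLIntegral_withDensity_eq_setLIntegral_mul _ (ENNReal.measurable_ofReal.comp hJXm)
            (ENNReal.measurable_ofReal.comp (hrm.comp hΘXm)) (hΘXm (hMm hBm))
      _ = ∫⁻ e in ΘX ⁻¹' (M ⁻¹' B) ∩ T, ENNReal.ofReal (JX e) * ENNReal.ofReal (r (ΘX e)) ∂μE := by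
          rw [Measure.restrict_restrict (hΘXm (hMm hBm))]; rfl
  -- pointwise comparison of the integrands: `𝟙_{m⁻¹W}·rE ≤ 𝟙_{ΘX⁻¹M⁻¹B ∩ T}·(JX·(r∘ΘX))`
  have hpt : ∀ e, ((fun e => ΛY (M (ΘX e))) ⁻¹' W).indicator (fun e => ENNReal.ofReal (rE e)) e ≤
      (ΘX ⁻¹' (M ⁻¹' B) ∩ T).indicator (fun e => ENNReal.ofReal (JX e) * ENNReal.ofReal (r (ΘX e))) e := by
    intro e
    by_cases heW : e ∈ (fun e => ΛY (M (ΘX e))) ⁻¹' W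
    · rw [indicator_of_mem heW]
      by_cases heT₀ : e ∈ T₀
      · obtain ⟨u, huS, hu⟩ := hread e heT₀
        have hmu : ΛY (M (ΘX e)) = u := by rw [← hu, hΛΘ u huS]
        have heB : e ∈ ΘX ⁻¹' (M ⁻¹' B) ∩ T := by
          refine ⟨?_, hT₀T heT₀⟩
          show M (ΘX e) ∈ B
          rw [← hu]
          exact ⟨u, by rw [← hmu]; exact heW, rfl⟩
        rw [indicator_of_mem heB, ← ENNReal.ofReal_mul (hJX0 e)]
        refine ENNReal.ofReal_le_ofReal ?_
        rw [mul_comm]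
        exact hrEle e (hT₀T heT₀)
      · rw [hrET₀ e heT₀, ENNReal.ofReal_zero]
        exact bot_le
    · rw [indicator_of_notMem heW]
      exact bot_le
  have hstep2 : ∫⁻ e in ΘX ⁻¹' (M ⁻¹' B) ∩ T, ENNReal.ofReal (JX e) * ENNReal.ofReal (r (ΘX e)) ∂μE ≥
      ∫⁻ w in W, ENNReal.ofReal (IE w) ∂μY := by
    calc ∫⁻ e in ΘX ⁻¹' (M ⁻¹' B) ∩ T, ENNReal.ofReal (JX e) * ENNReal.ofReal (r (ΘX e)) ∂μE
        = ∫⁻ e, (ΘX ⁻¹' (M ⁻¹' B) ∩ T).indicator (fun e => ENNReal.ofReal (JX e) * ENNReal.ofReal (r (ΘX e))) e ∂μE :=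
          (lintegral_indicator ((hΘXm (hMm hBm)).inter hT.measurableSet) _).symm
      _ ≥ ∫⁻ e, ((fun e => ΛY (M (ΘX e))) ⁻¹' W).indicator (fun e => ENNReal.ofReal (rE e)) e ∂μE := lintegral_mono hpt
      _ = ∫⁻ e in (fun e => ΛY (M (ΘX e))) ⁻¹' W, ENNReal.ofReal (rE e) ∂μE := lintegral_indicator (hm hWm) _
      _ = (μE.withDensity fun e => ENNReal.ofReal (rE e)) ((fun e => ΛY (M (ΘX e))) ⁻¹' W) :=
          (withDensity_apply _ (hm hWm)).symm
      _ = ∫⁻ w in W, ENNReal.ofReal (IE w) ∂μY := hIE W hWm hWD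
  have hstep3 : ∫⁻ w in W, ENNReal.ofReal (IE w) ∂μY ≥ ENNReal.ofReal (IE u₀ / 2) * μY W := by
    rw [ge_iff_le, ← setLIntegral_const]
    exact setLIntegral_mono' hWm fun u hu => ENNReal.ofReal_le_ofReal (hWIE u hu).le
  -- assemble
  calc ENNReal.ofReal (IE u₀ / (4 * JY u₀)) * μG B
      ≤ ENNReal.ofReal (IE u₀ / (4 * JY u₀)) * (ENNReal.ofReal (2 * JY u₀) * μY W) := mul_le_mul' le_rfl hμGB_le
    _ = ENNReal.ofReal (IE u₀ / 2) * μY W := by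
        rw [← mul_assoc, ← ENNReal.ofReal_mul hc.le]
        congr 2
        field_simp
        ring
    _ ≤ ∫⁻ y in B, ENNReal.ofReal (I y) ∂μG :=
        (hstep3.le.trans (hstep2.le.trans hstep1.le)).trans (hI B hBm hBDG)

/-- ★★ **POSITIVITY TRANSFER THROUGH CHARTS**: in the setting of `density_ge_of_chartRead`, `0 < I (M (ΘX e₀))`.
[cite: HormanderALPDO1, §6.1, proof of Thm 6.1.2 (bookkeeping)] [cite: EvansGariepy1992, §1.6.1 Thm 1] -/
theorem density_pos_of_chartRead (μE : Measure E) (μY : Measure Y) (ν : Measure X) (μG : Measure G)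
    [IsLocallyFiniteMeasure μY] [μY.IsOpenPosMeasure]
    {ΘX : E → X} (hΘXm : Measurable ΘX) {T T₀ : Set E} (hT : IsOpen T) (hT₀T : T₀ ⊆ T) (hΘXT : IsOpen (ΘX '' T))
    {JX : E → ℝ} (hJXm : Measurable JX) (hJX0 : ∀ e, 0 ≤ JX e)
    (hcovX : ν.restrict (ΘX '' T) = ((μE.restrict T).withDensity fun e => ENNReal.ofReal (JX e)).map ΘX)
    {ΘY : Y → G} (hΘYm : Measurable ΘY) {S : Set Y} (hS : IsOpen S) (hΘYi : InjOn ΘY S) (hΘYc : ContinuousOn ΘY S)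
    (hΘYo : ∀ V : Set Y, V ⊆ S → IsOpen V → IsOpen (ΘY '' V)) {ΛY : G → Y} (hΛYm : Measurable ΛY)
    (hΛΘ : ∀ u ∈ S, ΛY (ΘY u) = u)
    {JY : Y → ℝ} (hJYm : Measurable JY) (hJYc : ContinuousOn JY S) (hJYpos : ∀ u ∈ S, 0 < JY u)
    (hcovY : μG.restrict (ΘY '' S) = ((μY.restrict S).withDensity fun u => ENNReal.ofReal (JY u)).map ΘY)
    {M : X → G} (hMm : Measurable M) {e₀ : E} (he₀ : e₀ ∈ T₀) (hread : ∀ e ∈ T₀, M (ΘX e) ∈ ΘY '' S)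
    {r : X → ℝ} (hrm : Measurable r)
    {rE : E → ℝ} (hrEle : ∀ e ∈ T, rE e ≤ r (ΘX e) * JX e) (hrET₀ : ∀ e, e ∉ T₀ → rE e = 0)
    {D : Set Y} (hD : IsOpen D) (hu₀D : ΛY (M (ΘX e₀)) ∈ D) {IE : Y → ℝ} (hIEc : ContinuousAt IE (ΛY (M (ΘX e₀))))
    (hIEpos : 0 < IE (ΛY (M (ΘX e₀))))
    (hIE : ∀ A : Set Y, MeasurableSet A → A ⊆ D →
      (μE.withDensity fun e => ENNReal.ofReal (rE e)) ((fun e => ΛY (M (ΘX e))) ⁻¹' A) = ∫⁻ w in A, ENNReal.ofReal (IE w) ∂μY)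
    {DG : Set G} (hDG : IsOpen DG) (hMaDG : M (ΘX e₀) ∈ DG) {I : G → ℝ} (hIc : ContinuousAt I (M (ΘX e₀)))
    (hI : ∀ B : Set G, MeasurableSet B → B ⊆ DG →
      (ν.withDensity fun x => ENNReal.ofReal (r x)) (M ⁻¹' B) ≤ ∫⁻ y in B, ENNReal.ofReal (I y) ∂μG) :
    0 < I (M (ΘX e₀)) := by
  have hJY₀ : 0 < JY (ΛY (M (ΘX e₀))) := by
    obtain ⟨u₀, hu₀S, hu₀⟩ := hread e₀ he₀
    rw [← hu₀, hΛΘ u₀ hu₀S]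
    exact hJYpos u₀ hu₀S
  exact lt_of_lt_of_le (div_pos hIEpos (by positivity))
    (density_ge_of_chartRead μE μY ν μG hΘXm hT hT₀T hΘXT hJXm hJX0 hcovX hΘYm hS hΘYi hΘYc hΘYo hΛYm hΛΘ hJYm hJYc hJYpos hcovY
      hMm he₀ hread hrm hrEle hrET₀ hD hu₀D hIEc hIEpos hIE hDG hMaDG hIc hI)

end Transfer

end Literature.MeasureTheory.Integral.PushforwardDensityPositivity

end
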